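import Summits.Ventures.PercRepro2.Harris

/-!
# The realisation of a positively associated pair of Bernoullis by a tree, and the two-observable split
(blind cell PercRepro2, p1 g27; the arithmetic of the second pocket reduction)

A pair of Bernoulli variables `(A, B)` with `P(A ∧ B) = q₁₂ ≥ q₁ q₂ = P(A) P(B)` is the law of
`(r ∧ s, r ∧ t)` for three independent Bernoullis of weights `r = q₁ q₂ / q₁₂`, `s = q₁₂ / q₂`,
`t = q₁₂ / q₁` (`realR`, `realS`, `realT`): `r s = q₁`, `r t = q₂`, `r s t = q₁₂`, all three in `[0, 1]`
(`realR_le_one` is the Harris inequality); the degenerate case `q₁₂ = 0` forces `q₁ q₂ = 0` and takes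
`r = 1, s = q₁, t = q₂`. `expect_bool_split2` splits an expectation along two Boolean observables in
terms of `P(h₁)`, `P(h₂)`, `P(h₁ ∧ h₂)`. Own code; standard axioms. -/

namespace Summit.Ventures.PercRepro2

namespace CaseOne

/-! ## The realisation of a positively associated pair by a tree -/

section RealDefs
variable {R : Type*} [Field R] [LinearOrder R]

/-- The weight of the stem `x – w`. -/
noncomputable def realR (q₁ q₂ q₁₂ : R) : R := if q₁₂ = 0 then 1 else q₁ * q₂ / q₁₂

/-- The weight of the branch `w – z₁`. -/
noncomputable def realS (q₁ q₂ q₁₂ : R) : R := if q₁₂ = 0 then q₁ else q₁₂ / q₂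

/-- The weight of the branch `w – z₂`. -/
noncomputable def realT (q₁ q₂ q₁₂ : R) : R := if q₁₂ = 0 then q₂ else q₁₂ / q₁

variable {q₁ q₂ q₁₂ : R}

/-- `r · s = q₁`. -/
lemma realR_mul_realS (h2 : q₁₂ ≤ q₂) (h0 : 0 ≤ q₁₂) :
    realR q₁ q₂ q₁₂ * realS q₁ q₂ q₁₂ = q₁ := by
  unfold realR realS
  by_cases h : q₁₂ = 0
  · simp [h]
  · have hq2 : q₂ ≠ 0 := fun h' => h (le_antisymm (h' ▸ h2) h0)
    simp only [h, if_false]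
    field_simp

/-- `r · t = q₂`. -/
lemma realR_mul_realT (h1 : q₁₂ ≤ q₁) (h0 : 0 ≤ q₁₂) :
    realR q₁ q₂ q₁₂ * realT q₁ q₂ q₁₂ = q₂ := by
  unfold realR realT
  by_cases h : q₁₂ = 0
  · simp [h]
  · have hq1 : q₁ ≠ 0 := fun h' => h (le_antisymm (h' ▸ h1) h0)
    simp only [h, if_false]
    field_simp

end RealDefs

section RealBounds
variable {R : Type*} [Field R] [LinearOrder R] [IsStrictOrderedRing R] {q₁ q₂ q₁₂ : R}

/-- `r · s · t = q₁₂` (Harris in the degenerate case). -/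
lemma realR_mul_realS_mul_realT (h1 : q₁₂ ≤ q₁) (h2 : q₁₂ ≤ q₂) (h0 : 0 ≤ q₁₂)
    (hH : q₁ * q₂ ≤ q₁₂) (hq1 : 0 ≤ q₁) (hq2 : 0 ≤ q₂) :
    realR q₁ q₂ q₁₂ * realS q₁ q₂ q₁₂ * realT q₁ q₂ q₁₂ = q₁₂ := by
  unfold realR realS realT
  by_cases h : q₁₂ = 0
  · simp only [h, if_true, one_mul]
    exact le_antisymm (h ▸ hH) (mul_nonneg hq1 hq2)
  · have hq1' : q₁ ≠ 0 := fun h' => h (le_antisymm (h' ▸ h1) h0)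
    have hq2' : q₂ ≠ 0 := fun h' => h (le_antisymm (h' ▸ h2) h0)
    simp only [h, if_false]
    field_simp

/-- `0 ≤ r`. -/
lemma realR_nonneg (h0 : 0 ≤ q₁₂) (hq1 : 0 ≤ q₁) (hq2 : 0 ≤ q₂) : 0 ≤ realR q₁ q₂ q₁₂ := by
  unfold realR
  split_ifs
  · exact zero_le_one
  · exact div_nonneg (mul_nonneg hq1 hq2) h0

/-- `r ≤ 1` (Harris). -/
lemma realR_le_one (h0 : 0 ≤ q₁₂) (hH : q₁ * q₂ ≤ q₁₂) : realR q₁ q₂ q₁₂ ≤ 1 := by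
  unfold realR
  split_ifs with h
  · exact le_rfl
  · exact div_le_one_of_le₀ hH h0

/-- `0 ≤ s`. -/
lemma realS_nonneg (h0 : 0 ≤ q₁₂) (hq1 : 0 ≤ q₁) (hq2 : 0 ≤ q₂) : 0 ≤ realS q₁ q₂ q₁₂ := by
  unfold realS
  split_ifs
  · exact hq1
  · exact div_nonneg h0 hq2

/-- `s ≤ 1`. -/
lemma realS_le_one (h2 : q₁₂ ≤ q₂) (hq1 : q₁ ≤ 1) (hq2 : 0 ≤ q₂) : realS q₁ q₂ q₁₂ ≤ 1 := by
  unfold realS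
  split_ifs
  · exact hq1
  · exact div_le_one_of_le₀ h2 hq2

/-- `0 ≤ t`. -/
lemma realT_nonneg (h0 : 0 ≤ q₁₂) (hq1 : 0 ≤ q₁) (hq2 : 0 ≤ q₂) : 0 ≤ realT q₁ q₂ q₁₂ := by
  unfold realT
  split_ifs
  · exact hq2
  · exact div_nonneg h0 hq1

/-- `t ≤ 1`. -/
lemma realT_le_one (h1 : q₁₂ ≤ q₁) (hq1 : 0 ≤ q₁) (hq2 : q₂ ≤ 1) : realT q₁ q₂ q₁₂ ≤ 1 := by
  unfold realT
  split_ifs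
  · exact hq2
  · exact div_le_one_of_le₀ h1 hq1

end RealBounds

/-! ## Splitting an expectation along two Boolean observables -/

section Split2
variable {E : Type*} [Fintype E] [DecidableEq E] {R : Type*} [CommRing R]

/-- An expectation split along two Boolean observables, in terms of `P(h₁)`, `P(h₂)`, `P(h₁ ∧ h₂)`. -/
theorem expect_bool_split2 (q : E → R) (h₁ h₂ : Config E → Bool) (G : Bool → Bool → R) :
    expect q (fun ω => G (h₁ ω) (h₂ ω)) =
      G true true * prob q {ω | h₁ ω = true ∧ h₂ ω = true} +
        G true false * (prob q {ω | h₁ ω = true} - prob q {ω | h₁ ω = true ∧ h₂ ω = true}) +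
        G false true * (prob q {ω | h₂ ω = true} - prob q {ω | h₁ ω = true ∧ h₂ ω = true}) +
        G false false * (1 - prob q {ω | h₁ ω = true} - prob q {ω | h₂ ω = true} +
          prob q {ω | h₁ ω = true ∧ h₂ ω = true}) := by
  have h1 : (1 : R) = ∑ ω : Config E, weight q ω := (sum_weight q).symm
  conv_rhs => rw [h1]
  unfold expect prob
  simp only [Finset.mul_sum, ← Finset.sum_sub_distrib, ← Finset.sum_add_distrib]
  refine Finset.sum_congr rfl fun ω _ => ?_
  by_cases a : h₁ ω = true <;> by_cases b : h₂ ω = true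
  · simp [a, b]
    ring
  · have b' : h₂ ω = false := by simpa using b
    simp [a, b']
    ring
  · have a' : h₁ ω = false := by simpa using a
    simp [a', b]
    ring
  · have a' : h₁ ω = false := by simpa using a
    have b' : h₂ ω = false := by simpa using b
    simp [a', b']
    ring

end Split2

end CaseOne

end Summit.Ventures.PercRepro2
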